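import Mathlib
import Summits.ResolutionOfSingularities.ResolutionOfSingularities.Theorems.WildQuotientsWildQuotientResolutionS1aInducedTorusRing
import Literature.AlgebraicGeometry.Resolution.FormalFibresInseparable
import Literature.AlgebraicGeometry.Resolution.GeometricallyRegularFG

/-!
# The induced-torus ring is regular (faithfully flat descent from the Laurent ring), modulo «Laurent is regular»
(crux stmt-ResolutionOfSingularities-17941 `WildQuotients.CyclicQuotientFourfolds`, line B `s1a-tamebr`, (S1)
`S1.TameToBR.InducedTorusStatement`; plan-1 ASSIGN 2026-08-27T19:48:55Z. [OURS · L1 W4.5c] — NOT statements of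
the manuscript; counted 0. Owner res-L1-w45c-stub-4 (gen 5).)

`R = ⊕_λ 𝒜(λ mod r)` embeds in the Laurent ring `L = B[ℤᵐ]` (`InducedTorus.toLaurent`: `(a in degree λ) ↦ a·y^λ`,
injective, `coeff_toLaurent`), and `L` is a FREE `R`-module with basis `(y^{λ_δ})_{δ ∈ Π ZMod (r j)}`, one lift
`λ_δ = sect δ` per residue (`InducedTorus.laurent_free`: the `R`-linear map `(Π ZMod (r j) →₀ R) → L`,
`c ↦ Σ_δ toLaurent (c δ) · y^{λ_δ}` is bijective — surjective because `b·y^ν = (b in degree ν − λ_δ)·y^{λ_δ}` for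
`b ∈ 𝒜(ν mod r − δ)`, injective by reading off the `B`-degrees of the coefficients). Hence `R → L` is faithfully
flat, and `R` is Noetherian and REGULAR as soon as `L` is (`isNoetherianRing_of_faithfullyFlat`,
`isRegularRing_of_faithfullyFlat`).
* `InducedTorus.LaurentRegular` — the ONE remaining typed statement (OURS `Prop`, textbook: the Laurent polynomial
  ring in finitely many variables over a regular ring is regular; intended proof: `L ≃ Localization.Away (∏ Xᵢ)
  (MvPolynomial (Fin m) B)`, `MvPolynomial.isRegularRing_of_isRegularRing`, `isRegularRing_localization`);
* **`InducedTorus.isRegularRing_of_laurentRegular`** — REAL: `LaurentRegular → IsRegularRing B → IsRegularRing R`.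
-/

set_option linter.dupNamespace false

noncomputable section

open DirectSum AddMonoidAlgebra

namespace Summit.ResolutionOfSingularities.ResolutionOfSingularities.Theorems.WildQuotientResolution.S1.InducedTorus

variable {m : ℕ} (r : Fin m → ℕ) {k : Type} [Field k] {B : Type} [CommRing B] [Algebra k B]
  (𝒜 : (Π j : Fin m, ZMod (r j)) → Submodule k B)

/-! ## Direct instances on `InducedRing` (instance search does not unfold the abbreviation in nested goals) -/

/-- `InducedRing` is an additive commutative group (direct instance). [OURS · L1 W4.5c] -/
instance instAddCommGroupInducedRing : AddCommGroup (InducedRing r 𝒜) := inferInstance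

/-- `InducedRing` is a commutative ring (direct instance). [OURS · L1 W4.5c] -/
instance instCommRingInducedRing [SetLike.GradedMonoid 𝒜] : CommRing (InducedRing r 𝒜) := inferInstance

/-! ## The embedding into the Laurent ring -/

/-- The `λ`-th component map `a ↦ a · y^λ` into the Laurent ring `B[ℤᵐ]`. [OURS · L1 W4.5c] -/
def toLaurentComponent (l : Fin m → ℤ) : ↥(pull r 𝒜 l) →+ AddMonoidAlgebra B (Fin m → ℤ) where
  toFun a := single l (a : B)
  map_zero' := by simp
  map_add' a b := by simp [single_add]

/-- The value of the component map. [OURS · L1 W4.5c] -/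
@[simp] theorem toLaurentComponent_apply (l : Fin m → ℤ) (a : ↥(pull r 𝒜 l)) :
    toLaurentComponent r 𝒜 l a = single l (a : B) := rfl

variable [GradedAlgebra 𝒜]

/-- The additive map `R → B[ℤᵐ]`, `(a in degree λ) ↦ a · y^λ`. [OURS · L1 W4.5c] -/
def toLaurentAdd : InducedRing r 𝒜 →+ AddMonoidAlgebra B (Fin m → ℤ) :=
  DirectSum.toAddMonoid (toLaurentComponent r 𝒜)

/-- `toLaurentAdd (a in degree λ) = a · y^λ`. [OURS · L1 W4.5c] -/
@[simp] theorem toLaurentAdd_of (l : Fin m → ℤ) (a : ↥(pull r 𝒜 l)) :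
    toLaurentAdd r 𝒜 (DirectSum.of (fun μ => ↥(pull r 𝒜 μ)) l a) = single l (a : B) := by
  rw [toLaurentAdd, DirectSum.toAddMonoid_of, toLaurentComponent_apply]

/-- `toLaurentAdd` is multiplicative on homogeneous elements. [OURS · L1 W4.5c] -/
theorem toLaurentAdd_of_mul_of (i j : Fin m → ℤ) (a : ↥(pull r 𝒜 i)) (b : ↥(pull r 𝒜 j)) :
    toLaurentAdd r 𝒜 (DirectSum.of (fun μ => ↥(pull r 𝒜 μ)) i a * DirectSum.of (fun μ => ↥(pull r 𝒜 μ)) j b) =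
      toLaurentAdd r 𝒜 (DirectSum.of (fun μ => ↥(pull r 𝒜 μ)) i a) *
        toLaurentAdd r 𝒜 (DirectSum.of (fun μ => ↥(pull r 𝒜 μ)) j b) := by
  rw [DirectSum.of_mul_of (A := fun μ => ↥(pull r 𝒜 μ)), toLaurentAdd_of, toLaurentAdd_of, toLaurentAdd_of,
    SetLike.coe_gMul, single_mul_single]

/-- `toLaurentAdd` is multiplicative. [OURS · L1 W4.5c] -/
theorem toLaurentAdd_mul (x y : InducedRing r 𝒜) :
    toLaurentAdd r 𝒜 (x * y) = toLaurentAdd r 𝒜 x * toLaurentAdd r 𝒜 y := by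
  induction x using DirectSum.induction_on generalizing y with
  | zero => rw [zero_mul, map_zero, zero_mul]
  | add x₁ x₂ h₁ h₂ => rw [add_mul, map_add, map_add, h₁, h₂, add_mul]
  | of i a =>
    induction y using DirectSum.induction_on with
    | zero => rw [mul_zero, map_zero, mul_zero]
    | add y₁ y₂ h₁ h₂ => rw [mul_add, map_add, map_add, h₁, h₂, mul_add]
    | of j b => exact toLaurentAdd_of_mul_of r 𝒜 i j a b

/-- `toLaurentAdd 1 = 1`. [OURS · L1 W4.5c] -/
theorem toLaurentAdd_one : toLaurentAdd r 𝒜 1 = 1 := by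
  rw [DirectSum.one_def (fun μ => ↥(pull r 𝒜 μ)), toLaurentAdd_of, SetLike.coe_gOne, AddMonoidAlgebra.one_def]

/-- **The embedding `R → B[ℤᵐ]`**, `(a in degree λ) ↦ a · y^λ`, as a ring homomorphism. [OURS · L1 W4.5c] -/
def toLaurent : InducedRing r 𝒜 →+* AddMonoidAlgebra B (Fin m → ℤ) :=
  { toLaurentAdd r 𝒜 with
    map_one' := toLaurentAdd_one r 𝒜
    map_mul' := toLaurentAdd_mul r 𝒜 }

/-- `toLaurent x = toLaurentAdd x`. [OURS · L1 W4.5c] -/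
theorem toLaurent_apply (x : InducedRing r 𝒜) : toLaurent r 𝒜 x = toLaurentAdd r 𝒜 x := rfl

/-- `toLaurent (a in degree λ) = a · y^λ`. [OURS · L1 W4.5c] -/
@[simp] theorem toLaurent_of (l : Fin m → ℤ) (a : ↥(pull r 𝒜 l)) :
    toLaurent r 𝒜 (DirectSum.of (fun μ => ↥(pull r 𝒜 μ)) l a) = single l (a : B) :=
  toLaurentAdd_of r 𝒜 l a

/-- **Coefficients of `toLaurent`**: the `y^ν`-coefficient of `toLaurent x` is the `ν`-th component of `x`.
[OURS · L1 W4.5c] -/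
theorem coeff_toLaurent (x : InducedRing r 𝒜) (ν : Fin m → ℤ) :
    (toLaurent r 𝒜 x).coeff ν = ((x ν : ↥(pull r 𝒜 ν)) : B) := by
  classical
  induction x using DirectSum.induction_on with
  | zero => simp
  | add x y hx hy =>
    rw [map_add, AddMonoidAlgebra.coeff_add, Finsupp.add_apply, hx, hy, DirectSum.add_apply]; rfl
  | of l a =>
    rw [toLaurent_of]
    change Finsupp.single l (a : B) ν = _
    rw [Finsupp.single_apply]
    by_cases h : l = ν
    · subst h; rw [if_pos rfl, DirectSum.of_eq_same]
    · rw [if_neg h, DirectSum.of_eq_of_ne (β := fun μ => ↥(pull r 𝒜 μ)) l ν a (fun e => h e.symm)]; rfl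

/-- `toLaurent` is injective. [OURS · L1 W4.5c] -/
theorem toLaurent_injective : Function.Injective (toLaurent r 𝒜) := by
  intro x y h
  refine DFinsupp.ext fun ν => Subtype.ext ?_
  rw [← coeff_toLaurent, ← coeff_toLaurent, h]

/-! ## The residual: Laurent polynomial rings over regular rings are regular -/

/-- **The remaining typed statement** (textbook): for a regular (Noetherian) commutative ring `B`, the Laurent
polynomial ring `B[y₁^{±1},…,y_m^{±1}] = AddMonoidAlgebra B (Fin m → ℤ)` is a regular ring. [OURS · L1 W4.5c] —
a `Prop`, NOT asserted here (intended: `≃ Localization.Away (∏ Xᵢ) (MvPolynomial (Fin m) B)`). -/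
def LaurentRegular : Prop :=
  ∀ (B : Type) [CommRing B] (m : ℕ), IsRegularRing B → IsRegularRing (AddMonoidAlgebra B (Fin m → ℤ))

/-! ## Freeness of the Laurent ring over `R` and descent -/

section Descent

/-- A section of `torusDeg` (least non-negative lifts). [OURS · L1 W4.5c] -/
def lift (d : Π j : Fin m, ZMod (r j)) : Fin m → ℤ := fun j => ((d j).cast : ℤ)

omit [GradedAlgebra 𝒜] in
/-- `torusDeg (lift d) = d`. [OURS · L1 W4.5c] -/
@[simp] theorem torusDeg_lift (d : Π j : Fin m, ZMod (r j)) : torusDeg r (lift r d) = d :=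
  funext fun j => by rw [torusDeg_apply]; exact ZMod.intCast_zmod_cast (d j)

omit [GradedAlgebra 𝒜] in
/-- Components at equal indices have equal values in `B`. [OURS · L1 W4.5c] -/
theorem coe_apply_congr [SetLike.GradedMonoid 𝒜] (x : InducedRing r 𝒜) {t t' : Fin m → ℤ} (h : t = t') :
    ((x t : ↥(pull r 𝒜 t)) : B) = ((x t' : ↥(pull r 𝒜 t')) : B) := by
  subst h; rfl

-- the descent argument: explicit basis of `B[ℤᵐ]` over `R`
set_option maxHeartbeats 1600000 in
/-- **`R` is regular if `B` is, modulo «Laurent is regular».** `B[ℤᵐ]` is a free `R`-module on the `y^{lift δ}`,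
`δ ∈ Π ZMod (r j)` (bijectivity of `c ↦ Σ_δ toLaurent (c δ)·y^{lift δ}`), hence faithfully flat over `R`; regularity
and Noetherianity descend. [OURS · L1 W4.5c] -/
theorem isRegularRing_of_laurentRegular (hL : LaurentRegular) (hB : IsRegularRing B) :
    IsRegularRing (InducedRing r 𝒜) := by
  classical
  letI alg : Algebra (InducedRing r 𝒜) (AddMonoidAlgebra B (Fin m → ℤ)) := (toLaurent r 𝒜).toAlgebra
  have halg : ∀ x : InducedRing r 𝒜,
      algebraMap (InducedRing r 𝒜) (AddMonoidAlgebra B (Fin m → ℤ)) x = toLaurent r 𝒜 x := fun _ => rfl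
  haveI : IsRegularRing (AddMonoidAlgebra B (Fin m → ℤ)) := hL B m hB
  -- the basis vectors `y^{lift δ}` and the candidate isomorphism `Θ`
  let v : (Π j : Fin m, ZMod (r j)) → AddMonoidAlgebra B (Fin m → ℤ) := fun δ => single (lift r δ) 1
  let Θ : ((Π j : Fin m, ZMod (r j)) →₀ InducedRing r 𝒜) →ₗ[InducedRing r 𝒜] AddMonoidAlgebra B (Fin m → ℤ) :=
    Finsupp.linearCombination (InducedRing r 𝒜) v
  have hΘsingle : ∀ (δ : Π j : Fin m, ZMod (r j)) (x : InducedRing r 𝒜),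
      Θ (Finsupp.single δ x) = toLaurent r 𝒜 x * single (lift r δ) 1 := by
    intro δ x
    rw [Finsupp.linearCombination_single, Algebra.smul_def, halg]
  -- coefficients of `Θ c`
  have hΘcoeff : ∀ (c : (Π j : Fin m, ZMod (r j)) →₀ InducedRing r 𝒜) (ν : Fin m → ℤ),
      (Θ c).coeff ν = ∑ δ ∈ c.support, ((c δ (ν + -lift r δ) : ↥(pull r 𝒜 (ν + -lift r δ))) : B) := by
    intro c ν
    rw [Finsupp.linearCombination_apply, Finsupp.sum, AddMonoidAlgebra.coeff_sum, Finsupp.finsetSum_apply]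
    refine Finset.sum_congr rfl fun δ _ => ?_
    rw [Algebra.smul_def, halg, AddMonoidAlgebra.coeff_mul_single_apply, mul_one, coeff_toLaurent]
  -- injectivity: all coefficients vanish, `𝒜`-degree by `𝒜`-degree
  have hinj : Function.Injective Θ := by
    intro c₁ c₂ h12
    rw [← sub_eq_zero] at h12 ⊢
    rw [← map_sub] at h12
    generalize c₁ - c₂ = c at h12 ⊢
    have hzero : ∀ (δ : Π j : Fin m, ZMod (r j)) (ν : Fin m → ℤ),
        ((c δ (ν + -lift r δ) : ↥(pull r 𝒜 (ν + -lift r δ))) : B) = 0 := by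
      intro δ ν
      have hν : ∑ δ' ∈ c.support, ((c δ' (ν + -lift r δ') : ↥(pull r 𝒜 (ν + -lift r δ'))) : B) = 0 := by
        rw [← hΘcoeff, h12]; rfl
      -- project on the `𝒜`-degree `torusDeg ν - δ`
      have hproj := congrArg (GradedRing.proj 𝒜 (torusDeg r ν - δ)) hν
      rw [map_sum, map_zero] at hproj
      have hterm : ∀ δ' ∈ c.support, GradedRing.proj 𝒜 (torusDeg r ν - δ)
          ((c δ' (ν + -lift r δ') : ↥(pull r 𝒜 (ν + -lift r δ'))) : B) =
          if δ' = δ then ((c δ' (ν + -lift r δ') : ↥(pull r 𝒜 (ν + -lift r δ'))) : B) else 0 := by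
        intro δ' _
        have hmem : ((c δ' (ν + -lift r δ') : ↥(pull r 𝒜 (ν + -lift r δ'))) : B) ∈ 𝒜 (torusDeg r ν - δ') := by
          have h := (c δ' (ν + -lift r δ')).2
          rw [mem_pull_iff, map_add, map_neg, torusDeg_lift, ← sub_eq_add_neg] at h
          exact h
        rw [GradedRing.proj_apply]
        by_cases hδ : δ' = δ
        · subst hδ
          rw [if_pos rfl]
          exact DirectSum.decompose_of_mem_same 𝒜 hmem
        · rw [if_neg hδ]
          exact DirectSum.decompose_of_mem_ne 𝒜 hmem (fun h => hδ (sub_right_injective h))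
      rw [Finset.sum_congr rfl hterm, Finset.sum_ite_eq' c.support δ] at hproj
      by_cases hδc : δ ∈ c.support
      · rw [if_pos hδc] at hproj; exact hproj
      · rw [Finsupp.notMem_support_iff.mp hδc]; rfl
    ext δ μ
    have h := hzero δ (μ + lift r δ)
    rw [coe_apply_congr r 𝒜 (c δ) (show μ + lift r δ + -lift r δ = μ by abel)] at h
    rw [h]; rfl
  -- surjectivity: `b·y^ν` for homogeneous `b` is a basis vector times an element of `R`
  have hsurj : Function.Surjective Θ := by
    rw [← LinearMap.range_eq_top, eq_top_iff]
    rintro f -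
    induction f using AddMonoidAlgebra.induction_linear with
    | zero => exact Submodule.zero_mem _
    | add f g hf hg => exact Submodule.add_mem _ hf hg
    | single ν b =>
      rw [← DirectSum.sum_support_decompose 𝒜 b,
        show single ν (∑ γ ∈ (DirectSum.decompose 𝒜 b).support, ((DirectSum.decompose 𝒜 b γ : ↥(𝒜 γ)) : B)) =
          ∑ γ ∈ (DirectSum.decompose 𝒜 b).support, single ν ((DirectSum.decompose 𝒜 b γ : ↥(𝒜 γ)) : B) from
          map_sum (AddMonoidAlgebra.singleAddHom ν) _ _]
      refine Submodule.sum_mem _ fun γ _ => ?_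
      have hmem : ((DirectSum.decompose 𝒜 b γ : ↥(𝒜 γ)) : B) ∈ pull r 𝒜 (ν + -lift r (torusDeg r ν - γ)) := by
        rw [mem_pull_iff, map_add, map_neg, torusDeg_lift, show torusDeg r ν + -(torusDeg r ν - γ) = γ by abel]
        exact (DirectSum.decompose 𝒜 b γ).2
      have e : single ν ((DirectSum.decompose 𝒜 b γ : ↥(𝒜 γ)) : B) =
          Θ (Finsupp.single (torusDeg r ν - γ)
            (DirectSum.of (fun μ => ↥(pull r 𝒜 μ)) (ν + -lift r (torusDeg r ν - γ)) ⟨_, hmem⟩)) := by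
        rw [hΘsingle, toLaurent_of, single_mul_single, mul_one,
          show ν + -lift r (torusDeg r ν - γ) + lift r (torusDeg r ν - γ) = ν by abel]
      rw [e]
      exact LinearMap.mem_range_self Θ _
  -- faithful flatness and descent
  let eΘ := LinearEquiv.ofBijective Θ ⟨hinj, hsurj⟩
  haveI : Nonempty (Π j : Fin m, ZMod (r j)) := ⟨0⟩
  haveI : Module.FaithfullyFlat (InducedRing r 𝒜) ((Π j : Fin m, ZMod (r j)) →₀ InducedRing r 𝒜) :=
    Module.FaithfullyFlat.finsupp (R := InducedRing r 𝒜) _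
  haveI hff : Module.FaithfullyFlat (InducedRing r 𝒜) (AddMonoidAlgebra B (Fin m → ℤ)) :=
    Module.FaithfullyFlat.of_linearEquiv (InducedRing r 𝒜) ((Π j : Fin m, ZMod (r j)) →₀ InducedRing r 𝒜) eΘ.symm
  haveI : IsNoetherianRing (InducedRing r 𝒜) :=
    Literature.AlgebraicGeometry.Resolution.isNoetherianRing_of_faithfullyFlat (InducedRing r 𝒜)
      (AddMonoidAlgebra B (Fin m → ℤ))
  exact Literature.AlgebraicGeometry.Resolution.isRegularRing_of_faithfullyFlat (InducedRing r 𝒜)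
    (AddMonoidAlgebra B (Fin m → ℤ))

end Descent

end Summit.ResolutionOfSingularities.ResolutionOfSingularities.Theorems.WildQuotientResolution.S1.InducedTorus

end
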